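import Summits.HodgeConjecture.HodgeConjecture.Theorems.Ring2HypothesesDescentMotivatedTraceFormulaPairing
import Summits.HodgeConjecture.HodgeConjecture.Theorems.Ring2AbelianAllAndreKunnethAbelianVariety
import Literature.AlgebraicGeometry.HodgeTheory.AbsoluteHodgeClassesKunnethComponentsExist
import Literature.AlgebraicGeometry.Motives.AbelianVarietyCohomologyExteriorH1
import HarnessLib

/-!
# Ring 2 hypotheses, descent face — THE KÜNNETH COMPONENTS OF THE DIAGONAL OF A COMPLEX ABELIAN VARIETY ARE ALGEBRAIC,
# IN CLASS FORM (Grothendieck's `C(A)` as Deligne's Ex. 2.1 (b) reads it), and their diagonal restrictions do not vanish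

research route conditional on HC_CM; not a corollary; Q11.4-sentence-2 already refuted in dim ≥ 3.
Cell `pub-hodge-ring2` (Hodge ladder STAGE 3), seat `ring2-b05` (binder row b05 `Ring2.Hypotheses.MotivatedImpliesAlgebraicAV`,
published modulo X = `Ring2.AbelianAll.LefschetzBCompactPencils`), gen 46, first file. `HC_CM`
(`Theses.RankFourFaces.CMAbelianHodge`) does not occur in this file; nothing here proves a case of the Hodge conjecture; no
binder is discharged. This file is the coefficient supply of the gen-46 brick «the even fibre-class Lefschetz node one rung
up carries the odd-degree fibre-class inverses» (second file): the partial trace over an abelian variety `B` needs ONE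
algebraic class on `B × B` lying in a SINGLE Künneth piece `Hᵉ(B) ⊗ H^{2g-e}(B)` and acting as the identity on `Hᵉ(B(ℂ); ℂ)`,
together with the non-vanishing of its restriction to the diagonal.

THE OBSERVATION. Part XXII-f (ab-andre-2, `exists_kunnethProjector_abelianVariety`) proved `C(A)` in OPERATOR form: for a
complex abelian variety `A` of dimension `g` and each `k ≤ 2g` ONE algebraic class `ϖ_k = Σ_n c_{k,n} [Γ_{[n]}]` acts on
`Hᵃ(A(ℂ); ℂ)` as `δ_{ak}`. Gen 37 of this seat proved, on the same carriers, that a class in `H^{2g}((A ⊗ A)(ℂ); ℂ)` is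
DETERMINED by its total action (`eq_zero_of_forall_corrAction_eq_zero`, Kleiman 1968 §1.3) and that a cross product
`p₁^* x ∪ p₂^* y`, `x ∈ Hⁱ`, acts on `Hᵃ` only for `a = i` (`corrAction_cross_eq_zero_of_ne`). Hence for ANY Künneth
decomposition `cl(Δ_A) = Σᵢ πⁱ`, `πⁱ ∈ H^{2g-i}(A) ⊗ Hⁱ(A)` (they exist: `nonempty_kunnethComponents_diagonalClass`), the component
`πⁱ` acts as `δ_{a,2g-i}` (the others vanish on `H^{2g-i}` and the sum acts as `[Δ]_* = 1`), so `πⁱ = ϖ_{2g-i}` IS ALGEBRAIC —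
`C(A)` in the CLASS form of Deligne 1982 Ex. 2.1 (b) / Kleiman 1968 §2 («the Künneth components of the diagonal are
algebraic»), which the second file consumes as a class (it must be cupped, pulled back and whiskered, not only applied).
Gen 37's cohomological Lefschetz fixed-point formula `gradedTrace_corrAction_smul_one`
(`(Σₐ (-1)ᵃ Tr([u]_*|Hᵃ)) · 1 = p₁₊ p₂^* Δ^* u`) then gives `p₁₊ p₂^* Δ^* πⁱ = (-1)^{2g-i} b_{2g-i}(X) · 1`, so `Δ^* πⁱ ≠ 0`
whenever `b_{2g-i} ≠ 0` — for an abelian variety of positive dimension and `i = 2g - 1`, `b₁ = 2g ≠ 0`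
(`AbelianVariety.finrank_complexBetti_one`): the trace of the projector onto `H¹` is the coefficient the partial trace of
the second file has to invert.

* §1 `corrAction_eq_zero_of_mem_kunnethPiece_of_ne` (a Künneth piece `Hⁱ ⊗ Hʲ` acts only on `Hⁱ`),
  **`corrAction_kunnethComponent_diagonal`** (any Künneth decomposition of `cl(Δ_X)`, any smooth projective `X`: `πⁱ` acts as
  `δ_{a,2n-i} · 1` on `Hᵃ`), `gradedTrace_kunnethComponent_diagonal`, **`map_diagonal_kunnethComponent_ne_zero`**
  (`Δ^* πⁱ ≠ 0` when `b_{2n-i}(X) ≠ 0`).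
* §2 **`kunnethComponent_diagonal_mem_algebraicClasses`** — for a complex abelian variety EVERY member of EVERY Künneth
  decomposition of `cl(Δ_A)` is an algebraic class; `exists_algebraic_kunnethComponents_diagonal`; the `H¹`-projector:
  **`exists_kunnethProjectorClass_one_abelianVariety`** — an algebraic `π ∈ H¹(A) ⊗ H^{2g-1}(A) ⊂ H^{2g}((A ⊗ A)(ℂ); ℂ)` acting as
  the identity on `H¹(A(ℂ); ℂ)` with `Δ^* π ≠ 0` (`g ≥ 1`).

HONEST COLUMN. No definition, no named fact, no sorry; everything is a theorem of the tree's real carriers. Count once theirs: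
`exists_kunnethProjector_abelianVariety` (ab-andre-2 XXII-f), `nonempty_kunnethComponents_diagonalClass`, `kunnethPiece`,
`diagonalClass` (Literature). NOT claimed: rationality of the components (so NOT Deligne's Ex. 2.1 (b) «absolute Hodge» for
abelian varieties, which would need the Vandermonde coefficients in `ℚ`), `C(X)` for any non-abelian `X`, anything on the
cell's nodes. References: Kleiman1968AlgebraicCycles (§1.3 Prop. 1.3.6, §2 and App. 2A); Deligne1982HodgeCycles (§2 Ex. 2.1 (b)
p. 15); MumfordAV1970 (§19); HatcherAT2002 (§3.2 Thm. 3.15–3.16); Andre1996Motifs (§2.1 p. 15, Prop. 3.1 p. 20).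
-/

noncomputable section

-- every declaration of this problem lives in `Summit.HodgeConjecture.HodgeConjecture.…` (summit = sub-problem)
set_option linter.dupNamespace false

open CategoryTheory AlgebraicGeometry MonoidalCategory CartesianMonoidalCategory
open Literature.AlgebraicTopology.SingularHomology
open Literature.AlgebraicGeometry Literature.AlgebraicGeometry.Motives Literature.AlgebraicGeometry.HodgeTheory
open Summit.HodgeConjecture.HodgeConjecture.Ring2.AbelianAll (exists_kunnethProjector_abelianVariety)

namespace Summit.HodgeConjecture.HodgeConjecture.Theorems

variable {n : ℕ} {X : SchemeOver ℂ}

/-! ## §1 Any Künneth decomposition of the diagonal: actions and graded traces of the components -/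

/-- **A Künneth piece `Hⁱ(X) ⊗ Hʲ(X) ⊂ H²ⁿ((X ⊗ X)(ℂ); ℂ)` acts only on `Hⁱ(X(ℂ); ℂ)`**: for `u` in the piece and `a ≠ i`,
`[u]_* = p₁₊(p₂^*(·) ∪ u) = 0` on `Hᵃ` (the piece is spanned by cross products, gen 37's `corrAction_cross_eq_zero_of_ne`).
[cite: Kleiman1968AlgebraicCycles, §1.3 Prop. 1.3.6] [cite: HatcherAT2002, §3.2 Thm. 3.15] -/
theorem corrAction_eq_zero_of_mem_kunnethPiece_of_ne (μ : OrientationFamily) (hX : IsSmoothProjective n X)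
    {i j a : ℕ} (hij : i + j = 2 * n) (hai : a ≠ i) {u : complexBetti (X ⊗ X) (2 * n)}
    (hu : u ∈ kunnethPiece X X hij) :
    corrAction μ hX hX (rfl : a + 2 * n = a + 2 * n) u = 0 := by
  rw [← LinearMap.mem_ker]
  refine (Submodule.span_le.mpr ?_) hu
  rintro _ ⟨x, y, rfl⟩
  exact LinearMap.mem_ker.mpr (corrAction_cross_eq_zero_of_ne μ hX hij hai x y)

/-- **The members of ANY Künneth decomposition `cl(Δ_X) = Σᵢ πⁱ` (`πⁱ ∈ H^{2n-i}(X) ⊗ Hⁱ(X)`) act as the Künneth projectors**: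
`[πⁱ]_* = 1` on `H^{2n-i}(X(ℂ); ℂ)` and `= 0` on every other `Hᵃ`, `a ≤ 2n` (the other members vanish on `H^{2n-i}` by §1,
and the sum acts as `[Δ]_* = 𝟙^* = 1`, gen 36's `corrAction_diagonalClass`). [cite: Kleiman1968AlgebraicCycles, §1.3 and §2]
[cite: Deligne1982HodgeCycles, §2 Example 2.1 (b) (p. 15)] -/
theorem corrAction_kunnethComponent_diagonal (hX : IsSmoothProjective n X)
    {π : Fin (2 * n + 1) → complexBetti (X ⊗ X) (2 * n)}
    (hπ : ∀ i : Fin (2 * n + 1), π i ∈ kunnethPiece X X (show (2 * n - (i : ℕ)) + i = 2 * n by omega))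
    (hΔ : ∑ i, π i = diagonalClass hX) (i : Fin (2 * n + 1)) (a : ℕ) :
    corrAction complexOrientationFamily hX hX (rfl : a + 2 * n = a + 2 * n) (π i) =
      if a = 2 * n - (i : ℕ) then LinearMap.id else 0 := by
  split_ifs with hai
  · have hΔact := (corrAction_diagonalClass complexOrientationFamily hX a).2
    change corrAction complexOrientationFamily hX hX (rfl : a + 2 * n = a + 2 * n) (diagonalClass hX) = LinearMap.id
      at hΔact
    rw [← hΔ, map_sum, Finset.sum_eq_single i] at hΔact
    · exact hΔact
    · intro j _ hji
      have hj := j.2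
      have hi := i.2
      exact corrAction_eq_zero_of_mem_kunnethPiece_of_ne _ hX _ (fun h ↦ hji (Fin.ext (by omega))) (hπ j)
    · intro hi
      exact absurd (Finset.mem_univ i) hi
  · exact corrAction_eq_zero_of_mem_kunnethPiece_of_ne _ hX _ hai (hπ i)

/-- **The graded trace of a Künneth component of the diagonal**: `Σ_{a ≤ 2n} (-1)ᵃ Tr([πⁱ]_* | Hᵃ(X(ℂ))) = (-1)^{2n-i} b_{2n-i}(X)`.
[cite: Kleiman1968AlgebraicCycles, §1.3 Prop. 1.3.6] -/
theorem gradedTrace_kunnethComponent_diagonal (hX : IsSmoothProjective n X)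
    {π : Fin (2 * n + 1) → complexBetti (X ⊗ X) (2 * n)}
    (hπ : ∀ i : Fin (2 * n + 1), π i ∈ kunnethPiece X X (show (2 * n - (i : ℕ)) + i = 2 * n by omega))
    (hΔ : ∑ i, π i = diagonalClass hX) (i : Fin (2 * n + 1)) :
    ∑ a ∈ Finset.range (2 * n + 1), (-1 : ℂ) ^ a *
        LinearMap.trace ℂ _ (corrAction complexOrientationFamily hX hX (rfl : a + 2 * n = a + 2 * n) (π i)) =
      (-1 : ℂ) ^ (2 * n - (i : ℕ)) * (Module.finrank ℂ (complexBetti X (2 * n - (i : ℕ))) : ℂ) := by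
  have hi := i.2
  haveI : Module.Finite ℂ (complexBetti X (2 * n - (i : ℕ))) := finite_complexBetti hX _
  rw [Finset.sum_eq_single (2 * n - (i : ℕ))]
  · rw [corrAction_kunnethComponent_diagonal hX hπ hΔ i, if_pos rfl, LinearMap.trace_id]
  · intro a _ ha
    rw [corrAction_kunnethComponent_diagonal hX hπ hΔ i, if_neg ha, map_zero, mul_zero]
  · intro h
    exact absurd (Finset.mem_range.mpr (by omega)) h

/-- **`p₁₊ p₂^* Δ^* πⁱ = (-1)^{2n-i} b_{2n-i}(X) · 1_X`** (gen 37's cohomological Lefschetz fixed-point formula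
`gradedTrace_corrAction_smul_one` evaluated on a Künneth component of the diagonal). [cite: Kleiman1968AlgebraicCycles, §1.3 Prop. 1.3.6]
[cite: HatcherAT2002, §3.2 Thm. 3.16] -/
theorem fibreIntegral_map_diagonal_kunnethComponent (hX : IsSmoothProjective n X)
    {π : Fin (2 * n + 1) → complexBetti (X ⊗ X) (2 * n)}
    (hπ : ∀ i : Fin (2 * n + 1), π i ∈ kunnethPiece X X (show (2 * n - (i : ℕ)) + i = 2 * n by omega))
    (hΔ : ∑ i, π i = diagonalClass hX) (i : Fin (2 * n + 1)) :
    complexGysin complexOrientationFamily (IsSmoothProjective.tensor_holds hX hX) hX (fst X X)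
        (show 2 * n + 2 * n = 0 + 2 * (n + n) by omega)
        (complexBetti.map (snd X X) (2 * n) (complexBetti.map (lift (𝟙 X) (𝟙 X)) (2 * n) (π i))) =
      ((-1 : ℂ) ^ (2 * n - (i : ℕ)) * (Module.finrank ℂ (complexBetti X (2 * n - (i : ℕ))) : ℂ)) •
        singularCohomology.one ℂ (ComplexPoints X) := by
  rw [← gradedTrace_corrAction_smul_one complexOrientationFamily hX (π i), gradedTrace_kunnethComponent_diagonal hX hπ hΔ i]

/-- **`Δ^* πⁱ ≠ 0` whenever `b_{2n-i}(X) ≠ 0`**: the restriction to the diagonal of the Künneth component of `cl(Δ)` acting on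
`H^{2n-i}` has fibre integral `± b_{2n-i} · 1_X ≠ 0` (`1_X ≠ 0`, gen 37's `complexBetti_one_ne_zero`).
[cite: Kleiman1968AlgebraicCycles, §1.3 Prop. 1.3.6] [cite: HatcherAT2002, §3.3 Thm. 3.26] -/
theorem map_diagonal_kunnethComponent_ne_zero (hX : IsSmoothProjective n X)
    {π : Fin (2 * n + 1) → complexBetti (X ⊗ X) (2 * n)}
    (hπ : ∀ i : Fin (2 * n + 1), π i ∈ kunnethPiece X X (show (2 * n - (i : ℕ)) + i = 2 * n by omega))
    (hΔ : ∑ i, π i = diagonalClass hX) (i : Fin (2 * n + 1))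
    (hb : Module.finrank ℂ (complexBetti X (2 * n - (i : ℕ))) ≠ 0) :
    complexBetti.map (lift (𝟙 X) (𝟙 X)) (2 * n) (π i) ≠ 0 := by
  intro h0
  have h := fibreIntegral_map_diagonal_kunnethComponent hX hπ hΔ i
  rw [h0, map_zero, map_zero] at h
  have h1 := complexBetti_one_ne_zero hX
  rcases smul_eq_zero.mp h.symm with hc | hc
  · exact hb (by exact_mod_cast (mul_eq_zero.mp hc).resolve_left (pow_ne_zero _ (by norm_num)))
  · exact h1 hc

/-! ## §2 Complex abelian varieties: every Künneth component of the diagonal is an algebraic class -/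

/-- **`C(A)` IN CLASS FORM: for a complex abelian variety `A`, every member of every Künneth decomposition
`cl(Δ_A) = Σᵢ πⁱ`, `πⁱ ∈ H^{2g-i}(A) ⊗ Hⁱ(A)`, is an algebraic class on `A × A`** — `πⁱ` and part XXII-f's algebraic projector
`ϖ_{2g-i} = Σ_n c_n [Γ_{[n]}]` have the same action on every `Hᵃ(A(ℂ); ℂ)` (§1 and `exists_kunnethProjector_abelianVariety`), and
a class of codimension `g` on `A × A` is determined by its total action (gen 37's `eq_zero_of_forall_corrAction_eq_zero`).
[cite: Kleiman1968AlgebraicCycles, §2 and Appendix 2A] [cite: Deligne1982HodgeCycles, §2 Example 2.1 (b) (p. 15)]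
[cite: MumfordAV1970, §19] -/
theorem kunnethComponent_diagonal_mem_algebraicClasses (A : AbelianVariety ℂ)
    {π : Fin (2 * A.dim + 1) → complexBetti (A.X ⊗ A.X) (2 * A.dim)}
    (hπ : ∀ i : Fin (2 * A.dim + 1),
      π i ∈ kunnethPiece A.X A.X (show (2 * A.dim - (i : ℕ)) + i = 2 * A.dim by omega))
    (hΔ : ∑ i, π i = diagonalClass (AbelianVariety.isSmoothProjective_holds (A := A))) (i : Fin (2 * A.dim + 1)) :
    π i ∈ algebraicClasses (A.X ⊗ A.X) A.dim := by
  have hA : IsSmoothProjective A.dim A.X := AbelianVariety.isSmoothProjective_holds (A := A)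
  obtain ⟨ϖ, hϖ, hact⟩ := exists_kunnethProjector_abelianVariety A (2 * A.dim - (i : ℕ))
  suffices h : π i - ϖ = 0 by
    rw [sub_eq_zero] at h
    rwa [h]
  refine eq_zero_of_forall_corrAction_eq_zero complexOrientationFamily hA fun a ha ↦ ?_
  rw [map_sub, corrAction_kunnethComponent_diagonal hA hπ hΔ i a, hact a ha]
  split_ifs <;> simp

/-- **Grothendieck's Künneth standard conjecture `C(A)` for complex abelian varieties, in Deligne's form**: there is a Künneth
decomposition `cl(Δ_A) = Σ_{i ≤ 2g} πⁱ` (`πⁱ ∈ H^{2g-i}(A) ⊗ Hⁱ(A)`), and all its members are algebraic classes.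
[cite: Kleiman1968AlgebraicCycles, §2 and Appendix 2A] [cite: Deligne1982HodgeCycles, §2 Example 2.1 (b) (p. 15)] -/
theorem exists_algebraic_kunnethComponents_diagonal (A : AbelianVariety ℂ) :
    ∃ π : Fin (2 * A.dim + 1) → complexBetti (A.X ⊗ A.X) (2 * A.dim),
      (∀ i : Fin (2 * A.dim + 1),
        π i ∈ kunnethPiece A.X A.X (show (2 * A.dim - (i : ℕ)) + i = 2 * A.dim by omega)) ∧
      ∑ i, π i = diagonalClass (AbelianVariety.isSmoothProjective_holds (A := A)) ∧
      ∀ i, π i ∈ algebraicClasses (A.X ⊗ A.X) A.dim := by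
  obtain ⟨⟨π, hπ, hΔ⟩⟩ := nonempty_kunnethComponents_diagonalClass (AbelianVariety.isSmoothProjective_holds (A := A))
  exact ⟨π, hπ, hΔ, kunnethComponent_diagonal_mem_algebraicClasses A hπ hΔ⟩

/-- **THE ALGEBRAIC `H¹`-PROJECTOR AS A CLASS.** For a complex abelian variety `A` of dimension `g ≥ 1` there is a class
`π ∈ H^{2g}((A ⊗ A)(ℂ); ℂ)` which (i) is ALGEBRAIC, (ii) lies in the single Künneth piece `H¹(A) ⊗ H^{2g-1}(A)` (a finite sum of
cross products `p₁^* a ∪ p₂^* b`, `a ∈ H¹`, `b ∈ H^{2g-1}`), (iii) acts as the identity on `H¹(A(ℂ); ℂ)`, `[π]_* = p₁₊(p₂^*(·) ∪ π) = 1`,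
and (iv) has `Δ^* π ≠ 0` — indeed `p₁₊ p₂^* Δ^* π = -2g · 1_A` (`b₁(A) = 2g`, `AbelianVariety.finrank_complexBetti_one`). This is the
coefficient class of the partial trace of the second gen-46 file. [cite: Kleiman1968AlgebraicCycles, §2 and Appendix 2A]
[cite: MumfordAV1970, §1 (3) and §19] -/
theorem exists_kunnethProjectorClass_one_abelianVariety (A : AbelianVariety ℂ) (hg : 0 < A.dim) :
    ∃ π : complexBetti (A.X ⊗ A.X) (2 * A.dim),
      π ∈ algebraicClasses (A.X ⊗ A.X) A.dim ∧
      π ∈ kunnethPiece A.X A.X (show 1 + (2 * A.dim - 1) = 2 * A.dim by omega) ∧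
      corrAction complexOrientationFamily (AbelianVariety.isSmoothProjective_holds (A := A))
          (AbelianVariety.isSmoothProjective_holds (A := A)) (rfl : 1 + 2 * A.dim = 1 + 2 * A.dim) π = LinearMap.id ∧
      complexGysin complexOrientationFamily
          (IsSmoothProjective.tensor_holds (AbelianVariety.isSmoothProjective_holds (A := A))
            (AbelianVariety.isSmoothProjective_holds (A := A)))
          (AbelianVariety.isSmoothProjective_holds (A := A)) (fst A.X A.X)
          (show 2 * A.dim + 2 * A.dim = 0 + 2 * (A.dim + A.dim) by omega)
          (complexBetti.map (snd A.X A.X) (2 * A.dim) (complexBetti.map (lift (𝟙 A.X) (𝟙 A.X)) (2 * A.dim) π)) =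
        (-(2 * A.dim : ℂ)) • singularCohomology.one ℂ (ComplexPoints A.X) ∧
      complexBetti.map (lift (𝟙 A.X) (𝟙 A.X)) (2 * A.dim) π ≠ 0 := by
  have hA : IsSmoothProjective A.dim A.X := AbelianVariety.isSmoothProjective_holds (A := A)
  obtain ⟨π, hπ, hΔ, halg⟩ := exists_algebraic_kunnethComponents_diagonal A
  -- the member with second-factor degree `2g - 1`, first-factor degree `1`
  let i : Fin (2 * A.dim + 1) := ⟨2 * A.dim - 1, by omega⟩
  have hi : 2 * A.dim - (i : ℕ) = 1 := by
    change 2 * A.dim - (2 * A.dim - 1) = 1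
    omega
  have hb : Module.finrank ℂ (complexBetti A.X (2 * A.dim - (i : ℕ))) = 2 * A.dim := by
    rw [hi, AbelianVariety.finrank_complexBetti_one]
  refine ⟨π i, halg i, ?_, ?_, ?_, map_diagonal_kunnethComponent_ne_zero hA hπ hΔ i (by rw [hb]; omega)⟩
  · have h := hπ i
    have e : (2 * A.dim - (i : ℕ)) = 1 := hi
    revert h
    generalize_proofs h₁ h₂
    revert h₁
    rw [e]
    intro h₁ h
    exact h
  · have h := corrAction_kunnethComponent_diagonal hA hπ hΔ i 1
    rwa [if_pos hi.symm] at h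
  · rw [fibreIntegral_map_diagonal_kunnethComponent hA hπ hΔ i, hb, hi, pow_one]
    push_cast
    ring_nf

end Summit.HodgeConjecture.HodgeConjecture.Theorems

end
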